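import Summits.ResolutionOfSingularities.ResolutionOfSingularities.Theorems.EquisingularLiftEquisingularLiftNatCechShadowLocal
import Summits.ResolutionOfSingularities.ResolutionOfSingularities.Theorems.EquisingularLiftEquisingularLiftNatCechShadowTrace
import Summits.ResolutionOfSingularities.ResolutionOfSingularities.Theorems.EquisingularLiftEquisingularLiftNatExceptionalReducedModel
import Summits.ResolutionOfSingularities.ResolutionOfSingularities.Theorems.EquisingularLiftEquisingularLiftNatInCarrierStepFlat
import Summits.ResolutionOfSingularities.ResolutionOfSingularities.Theorems.EquisingularLiftEquisingularLiftNatStalkDimension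
import Summits.ResolutionOfSingularities.ResolutionOfSingularities.Theorems.EquisingularLiftEquisingularLiftNatModelStep
import Summits.ResolutionOfSingularities.ResolutionOfSingularities.Theorems.EquisingularLiftEquisingularLiftChainRegular
import Literature.AlgebraicGeometry.Resolution.AlterationsSemiStableCodimTwo
import Literature.AlgebraicGeometry.Resolution.KollarBlowupSequenceFunctors
import HarnessLib

/-!
# [OURS · L1 W4.5(b) · EL♮(3)] THE ČECH-SHADOW PACKAGE AT A POINT OF THE CENTRE TRACE, THE REDUCED NEW EXCEPTIONAL TRACE, AND THE
# DIMENSION BOUND `dim 𝒪_{X,x}/𝒞_x ≤ 2` (stage-level helpers of the (N3)/(N3′) dischargers of TOWER₄'s S6 `hCech`)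

Crux chain w45b (cell `res-hironaka`, slot W4.5(b)), working crux **EL♮** = stmt-ResolutionOfSingularities-20038, child **EL♮(3)** =
stmt-ResolutionOfSingularities-20148, route EquisingularLift, line `sections`; registered stub `stub_elnat_coneTowerPointResolution` @ `ReachTower₄`,
stand-in S6 `hCech`, sub-stand-ins (N3) `hShadow` / (N3′) `hShadowOld` of `Tower.hCech₃_of_lift_sec` (res-L1-w45b-stub-4 p576661) / `…_kiv`.
Written by res-L1-w45b-stub-2 g8 (res-L1-w45b-plan-1 RULING OF RECORD 2026-08-27T22:17:09Z). HONEST FRAMING: OURS; NOT a statement of any manuscript;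
AI-written, weaker than expert review. No `sorry`; standard axioms; DEF-FREE. `--supports stmt-ResolutionOfSingularities-20148 --as helper`.

WHAT. In the model square `jG : G ⟶ X` over `Spec θ` (`θ : O ↠ k`, `O` a DVR with uniformiser `ϖ`) of a stage, with the Čech centre `𝒞` (`V(𝒞)` regular,
`O`-flat, exact reduced trace `𝓘⟨Z⟩`) and the shadow `𝒦` (locally principal, trace `𝓘⟨K⟩` at the points of `Z`, `Z ⊆ closure (Z ∖ K)`):
* **`exists_cechShadow_package`** — at every `p ∈ Z`, `x = jG p`: a generator `f` of `𝒦_x` with (G1) `f` a nonzerodivisor modulo `𝒞_x + (ϖ_x)`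
  (…NatCechShadowTrace), `ϖ_x` a nonzerodivisor modulo `𝒞_x` (flatness, tree `mem_stalkIdeal_of_varpi_mul_mem_of_flat`) and `𝒞_x + (ϖ_x) ≠ ⊤` — exactly the
  hypotheses of …NatCechShadowLocal `exists_generator_cechShadow_local`;
* **`comap_comap_eq_vanishingIdeal_preimage_of_regular`** — the new exceptional surface of the blow-up `τ` of `𝒞` has exact REDUCED trace
  `(𝒞·𝒪_{X₂})·𝒪_{G′} = 𝓘⟨υ₂⁻¹ Z⟩` (tree `comap_comap_eq_vanishingIdeal_preimage_of_model` p?, its quasi-regular frames supplied by regularity as in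
  res-D-pv-029's `Tower.inv₂_coneRound_new`);
* **`ringKrullDim_stalk_le_of_chain`** — `dim 𝒪_{X,x} ≤ n + 1` at EVERY point of the special fibre of a `Chain` stage over `P` smooth of relative dimension
  `n` (T-DIM p513633 at a closed specialisation + Literature `ringKrullDim_stalk_lt_of_specializes`);
* **`ringKrullDim_quotient_centre_le`** — `dim 𝒪_{X,x}/𝒞_x ≤ d − 2` for `𝒞 = 𝓔 ⊔ 𝒦₁` with `𝓔 ≠ ⊥` principal and `𝒦₁|_{V(𝓔)}` effective Cartier,
  when `dim 𝒪_{X,x} ≤ d` (…NatCechShadowRing `ringKrullDim_quotient_sup_span_le`).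

References (index only): [cite: Liu2002, Thm. 8.1.19]; [cite: StacksProject, Tag 0BIQ]; [cite: Matsumura1987, Thm. 14.2]; tree files as named.
-/

set_option linter.dupNamespace false -- mandated namespace `Summit.<Summit>.<Problem>` of this single-conjunct summit
set_option linter.overlappingInstances false -- signatures carry `[IsDomain O] [IsDiscreteValuationRing O]`

noncomputable section

open CategoryTheory CategoryTheory.Limits AlgebraicGeometry TopologicalSpace Topology IsLocalRing
open Literature.AlgebraicGeometry.Resolution
open AlgebraicGeometry.Scheme.IdealSheafData
open Summit.ResolutionOfSingularities.ResolutionOfSingularities.Theses.EquisingularLift.Split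
open Summit.ResolutionOfSingularities.ResolutionOfSingularities.Cruxes.EquisingularLift.StrataSplit

namespace Summit.ResolutionOfSingularities.ResolutionOfSingularities.Cruxes.EquisingularLiftNat.Sections.CechShadow

/-! ## The package at a point of the centre trace -/

/-- **The Čech-shadow package at `p ∈ Z`** (see the module docstring): a generator `f` of `𝒦_{jG p}` with (G1), the flatness consequence for `ϖ`, and
properness of `𝒞_{jG p} + (ϖ)`. [cite: Matsumura1987, §16] [OURS · L1 W4.5b] (N3)/(N3′) of TOWER₄ S6; NOT a statement of the manuscript. -/
theorem exists_cechShadow_package (O : Type) [CommRing O] [IsDomain O] [IsDiscreteValuationRing O] (k : Type) [Field k]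
    (θ : O →+* k) (hθ : Function.Surjective θ) {X G : Scheme.{0}} [NoetherianSpace G] (r : X ⟶ Spec (.of O))
    (jG : G ⟶ X) (tG : G ⟶ Spec (.of k)) (hsq : IsPullback jG tG r (Spec.map (CommRingCat.ofHom θ)))
    (ϖ : O) (hϖ : Irreducible ϖ) (𝒞 𝒦 : X.IdealSheafData) (hCflat : Flat (𝒞.subschemeι ≫ r))
    (Z K : Set G) (hZ : IsClosed Z) (hK : IsClosed K) (hc1 : 𝒞.comap jG = vanishingIdeal (⟨Z, hZ⟩ : Closeds G))
    (hk_i : ∀ z : X, (stalkIdeal 𝒦 z).IsPrincipal)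
    (hKZ : ∀ p ∈ Z, stalkIdeal (𝒦.comap jG) p = stalkIdeal (vanishingIdeal (⟨K, hK⟩ : Closeds G)) p)
    (hoff : Z ⊆ closure (Z \ K)) (p : G) (hp : p ∈ Z) :
    ∃ f : X.presheaf.stalk (jG p), stalkIdeal 𝒦 (jG p) = Ideal.span {f} ∧
      (∀ a, f * a ∈ stalkIdeal 𝒞 (jG p) ⊔ Ideal.span {(X.presheaf.Γgerm (jG p)).hom (r.appTop.hom ((Scheme.ΓSpecIso (.of O)).inv.hom ϖ))} →
        a ∈ stalkIdeal 𝒞 (jG p) ⊔ Ideal.span {(X.presheaf.Γgerm (jG p)).hom (r.appTop.hom ((Scheme.ΓSpecIso (.of O)).inv.hom ϖ))}) ∧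
      (∀ a, (X.presheaf.Γgerm (jG p)).hom (r.appTop.hom ((Scheme.ΓSpecIso (.of O)).inv.hom ϖ)) * a ∈ stalkIdeal 𝒞 (jG p) →
        a ∈ stalkIdeal 𝒞 (jG p)) ∧
      stalkIdeal 𝒞 (jG p) ⊔ Ideal.span {(X.presheaf.Γgerm (jG p)).hom (r.appTop.hom ((Scheme.ΓSpecIso (.of O)).inv.hom ϖ))} ≠ ⊤ := by
  haveI := hCflat
  set ϖx := (X.presheaf.Γgerm (jG p)).hom (r.appTop.hom ((Scheme.ΓSpecIso (.of O)).inv.hom ϖ)) with hϖx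
  obtain ⟨f, hf⟩ := (hk_i (jG p)).principal
  have hf' : stalkIdeal 𝒦 (jG p) = Ideal.span {f} := by rw [hf, Ideal.submodule_span_eq]
  have hxC : jG p ∈ (𝒞.support : Set X) := by
    have h1 : p ∈ ((𝒞.comap jG).support : Set G) := by
      rw [hc1, Scheme.IdealSheafData.coe_support_vanishingIdeal]; exact hp
    rwa [Scheme.IdealSheafData.support_comap] at h1
  have h𝒞 : stalkIdeal (𝒞.comap jG) p = stalkIdeal (vanishingIdeal (⟨Z, hZ⟩ : Closeds G)) p := by rw [hc1]
  refine ⟨f, hf', ?_, ?_, ?_⟩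
  · exact fun a ha => mem_sup_span_of_mul_mem_of_model O k θ hθ r jG tG hsq ϖ hϖ 𝒞 𝒦 Z K hZ hK hoff p h𝒞 (hKZ p hp) f hf' a ha
  · exact fun a ha => mem_stalkIdeal_of_varpi_mul_mem_of_flat r 𝒞 (jG p) hxC hϖ.ne_zero a ha
  · -- `𝒞_x ⊆ 𝔪` and `ϖ_x ∈ 𝔪` (its image in `𝒪_{G,p} ≠ 0` vanishes)
    intro htop
    have h1 : ϖx ∈ maximalIdeal (X.presheaf.stalk (jG p)) := by
      rw [mem_maximalIdeal, mem_nonunits_iff]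
      intro hu
      have h0 := stalkMap_model_varpi θ hθ r jG tG hsq p ϖ (hϖ.maximalIdeal_eq ▸ Ideal.mem_span_singleton_self ϖ)
      have h2 := hu.map (jG.stalkMap p).hom
      rw [← hϖx] at h0
      rw [h0] at h2
      exact not_isUnit_zero h2
    have h2 : stalkIdeal 𝒞 (jG p) ⊔ Ideal.span {ϖx} ≤ maximalIdeal _ :=
      sup_le ((mem_support_iff_stalkIdeal_le _ _).mp hxC) ((Ideal.span_singleton_le_iff_mem _).mpr h1)
    exact (maximalIdeal.isMaximal _).ne_top (top_le_iff.mp (htop ▸ h2))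

/-! ## The new exceptional trace is reduced -/

/-- **`(𝒞·𝒪_{X₂})·𝒪_{G′} = 𝓘⟨υ₂⁻¹ Z⟩` from regularity** (`X` regular, `V(𝒞)` regular ⟹ quasi-regular frames of `𝒞` at the points over `Z`).
[cite: StacksProject, Tag 0BIQ] [cite: Liu2002, Thm. 8.1.19 (b)] [OURS · L1 W4.5b] -/
theorem comap_comap_eq_vanishingIdeal_preimage_of_regular (O : Type) [CommRing O] [IsDomain O] [IsDiscreteValuationRing O]
    (k : Type) [Field k] (θ : O →+* k) (hθ : Function.Surjective θ)
    {X X₂ G G' : Scheme.{0}} [IsLocallyNoetherian X] [IsLocallyNoetherian X₂] (r : X ⟶ Spec (.of O))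
    (jG : G ⟶ X) (tG : G ⟶ Spec (.of k)) (hsq : IsPullback jG tG r (Spec.map (CommRingCat.ofHom θ)))
    (𝒞 : X.IdealSheafData) (hXreg : Scheme.IsRegular X) (hCreg : Scheme.IsRegular 𝒞.subscheme)
    (τ : X₂ ⟶ X) (hτ : IsBlowup τ 𝒞) (j₂ : G' ⟶ X₂) (t₂ : G' ⟶ Spec (.of k))
    (hsq₂ : IsPullback j₂ t₂ (τ ≫ r) (Spec.map (CommRingCat.ofHom θ))) (υ₂ : G' ⟶ G) (hcomm : j₂ ≫ τ = υ₂ ≫ jG)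
    (Z : Set G) (hZ : IsClosed Z) (hc1 : 𝒞.comap jG = vanishingIdeal (⟨Z, hZ⟩ : Closeds G)) :
    (𝒞.comap τ).comap j₂ = vanishingIdeal (⟨υ₂ ⁻¹' Z, hZ.preimage υ₂.continuous⟩ : Closeds G') := by
  -- adapted from res-D-pv-029's `Tower.inv₂_coneRound_new` (…NatTowerConeRound, `hqr`)
  have hqr : ∀ z ∈ ((⟨Z, hZ⟩ : Closeds G) : Set G), ∃ (n : ℕ) (c : Fin n → X.presheaf.stalk (jG z)),
      Ideal.span (Set.range c) = stalkIdeal 𝒞 (jG z) ∧ IsQuasiRegular c := by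
    intro z hz
    have hzC : jG z ∈ (𝒞.support : Set X) := by
      have h1 : z ∈ ((𝒞.comap jG).support : Set G) := by
        rw [hc1, Scheme.IdealSheafData.coe_support_vanishingIdeal]; exact hz
      rwa [Scheme.IdealSheafData.support_comap] at h1
    haveI : IsRegularLocalRing (X.presheaf.stalk (jG z)) := hXreg (jG z)
    haveI : IsRegularLocalRing (X.presheaf.stalk (jG z) ⧸ stalkIdeal 𝒞 (jG z)) := isRegularLocalRing_stalk_quotient_stalkIdeal hCreg hzC
    obtain ⟨n, c, -, hc, hq, -⟩ := exists_isQuasiRegular_span_eq_of_isRegularLocalRing_quotient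
      (J := stalkIdeal 𝒞 (jG z)) ((mem_support_iff_stalkIdeal_le _ _).mp hzC) (stalkIdeal 𝒞 (jG z) : Set _) (Ideal.span_eq _)
    exact ⟨n, c, hc, hq⟩
  exact comap_comap_eq_vanishingIdeal_preimage_of_model O k θ hθ r jG tG hsq 𝒞 τ hτ j₂ t₂ hsq₂ υ₂ hcomm ⟨Z, hZ⟩ hc1 hqr

/-! ## Dimension bounds -/

/-- **`dim 𝒪_{X,x} ≤ n + 1` at every point of the special fibre** of a `Chain` stage `X → P` over `P` smooth of relative dimension `n` over the
DVR `O` (T-DIM at a closed specialisation of `x`, which stays in the special fibre). [cite: Liu2002, Thm. 8.1.19] [OURS · L1 W4.5b] -/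
theorem ringKrullDim_stalk_le_of_chain {O : Type} [CommRing O] [IsDomain O] [IsDiscreteValuationRing O]
    {P : Scheme.{0}} [IsIntegral P] (q : P ⟶ Spec (.of O)) [IsProper q] (n : ℕ) [SmoothOfRelativeDimension n q]
    {Y : Set P} (hYirr : IsIrreducible Y) (hYcl : IsClosed Y) (hPnoeth : IsLocallyNoetherian P) (hPreg : Scheme.IsRegular P)
    {X : Scheme.{0}} {σ : X ⟶ P} {S : Set X} (hCh : Chain P Y X σ S)
    (x : X) (hx : (σ ≫ q) x = closedPoint O) :
    ringKrullDim (X.presheaf.stalk x) ≤ (n + 1 : ℕ) := by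
  obtain ⟨hXnoeth, -, hσ⟩ := chain_isRegular P Y X σ S hCh hPnoeth hPreg
  haveI := hXnoeth
  haveI := hσ
  haveI : IsProper (σ ≫ q) := inferInstance
  haveI : CompactSpace X := QuasiCompact.compactSpace_of_compactSpace (σ ≫ q)
  -- a closed specialisation `x₀` of `x`
  obtain ⟨x₀, hx₀, hx₀cl⟩ := (isClosed_closure (s := ({x} : Set X))).exists_closed_singleton ⟨x, subset_closure rfl⟩
  have hsp : x ⤳ x₀ := specializes_iff_mem_closure.mpr hx₀
  -- `x₀` lies over the closed point as well
  have hx₀s : (σ ≫ q) x₀ = closedPoint O := by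
    have h1 : (σ ≫ q) x ⤳ (σ ≫ q) x₀ := hsp.map (σ ≫ q).continuous
    rw [hx] at h1
    have h3 : IsClosed ({closedPoint O} : Set (Spec (.of O))) := IsLocalRing.isClosed_singleton_closedPoint O
    exact Set.mem_singleton_iff.mp (h1.mem_closed h3 (Set.mem_singleton _))
  have hξ := hYirr.isGenericPoint_genericPoint hYcl
  have hd₀ := ringKrullDim_stalk_eq_succ_of_chain q n hξ hCh hx₀cl hx₀s
  by_cases heq : x = x₀
  · subst heq
    exact hd₀.le
  · exact ((ringKrullDim_stalk_lt_of_specializes hsp heq).trans_eq hd₀).le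

/-- **`dim 𝒪_{X,x}/𝒞_x ≤ d − 2`** for the Čech centre `𝒞 = 𝓔 ⊔ 𝒦₁` at `x ∈ V(𝒞)`: `𝓔 ≠ ⊥` locally principal on the integral regular `X` and
`𝒦₁|_{V(𝓔)}` an effective Cartier divisor, `dim 𝒪_{X,x} ≤ d`. [cite: Matsumura1987, Thm. 14.2] [OURS · L1 W4.5b] -/
theorem ringKrullDim_quotient_centre_le {X : Scheme.{0}} [IsIntegral X] [IsLocallyNoetherian X] (hXreg : Scheme.IsRegular X)
    (𝓔 𝒦₁ : X.IdealSheafData) (h𝓔 : 𝓔 ≠ ⊥) (he_ii : ∀ z : X, (stalkIdeal 𝓔 z).IsPrincipal)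
    (hc4 : IsEffectiveCartier (𝒦₁.comap 𝓔.subschemeι)) (x : X) (hx : x ∈ ((𝓔 ⊔ 𝒦₁).support : Set X)) {d : ℕ}
    (hd : ringKrullDim (X.presheaf.stalk x) ≤ d) :
    ringKrullDim (X.presheaf.stalk x ⧸ stalkIdeal (𝓔 ⊔ 𝒦₁) x) ≤ (d - 2 : ℕ) := by
  haveI : IsRegularLocalRing (X.presheaf.stalk x) := hXreg x
  haveI : IsDomain (X.presheaf.stalk x) := isDomain_of_isRegularLocalRing _
  have hxE : x ∈ (𝓔.support : Set X) := Scheme.IdealSheafData.support_antitone le_sup_left hx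
  have hCm : stalkIdeal (𝓔 ⊔ 𝒦₁) x ≤ maximalIdeal _ := (mem_support_iff_stalkIdeal_le _ _).mp hx
  -- the generator `e` of `𝓔_x`
  obtain ⟨e, he⟩ := (he_ii x).principal
  have he' : stalkIdeal 𝓔 x = Ideal.span {e} := by rw [he, Ideal.submodule_span_eq]
  have he0 : e ≠ 0 := by
    intro h0
    apply stalkIdeal_ne_bot_of_ne_bot h𝓔 x
    rw [he', h0, Ideal.span_singleton_eq_bot]
  have hem : e ∈ maximalIdeal _ := (mem_support_iff_stalkIdeal_le _ _).mp hxE (he'.symm ▸ Ideal.mem_span_singleton_self e)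
  -- the Cartier generator `d₁` of `𝒦₁·𝒪_{V(𝓔)}` at the point over `x`, lifted to `κ ∈ 𝒪_{X,x}`
  -- adapted from …NatTowerExceptionalDense `exists_specializes_mem_support_not_mem`
  obtain ⟨xe, hxe⟩ : x ∈ Set.range 𝓔.subschemeι := by rw [Scheme.IdealSheafData.range_subschemeι]; exact hxE
  subst hxe
  set φ := (𝓔.subschemeι.stalkMap xe).hom with hφ
  have hφsurj : Function.Surjective φ := 𝓔.subschemeι.stalkMap_surjective xe
  have hφker : RingHom.ker φ = stalkIdeal 𝓔 (𝓔.subschemeι xe) := by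
    rw [hφ, ← stalkIdeal_ker_eq_ker_stalkMap, Scheme.IdealSheafData.ker_subschemeι]
  obtain ⟨d₁, hd₁, hKd₁⟩ := hc4.exists_stalkIdeal_eq_span xe
  have hKd' : (stalkIdeal 𝒦₁ (𝓔.subschemeι xe)).map φ = Ideal.span {d₁} := by rw [← hKd₁, hφ, stalkIdeal_comap_eq_map_stalkMap]
  obtain ⟨κ, hκ⟩ := hφsurj d₁
  have hsum : stalkIdeal (𝓔 ⊔ 𝒦₁) (𝓔.subschemeι xe) = Ideal.span {e} ⊔ Ideal.span {κ} := by
    rw [stalkIdeal_sup, he']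
    have h1 : Ideal.comap φ ((stalkIdeal 𝒦₁ (𝓔.subschemeι xe)).map φ) = stalkIdeal 𝒦₁ (𝓔.subschemeι xe) ⊔ Ideal.span {e} := by
      rw [Ideal.comap_map_of_surjective _ hφsurj, ← RingHom.ker_eq_comap_bot, hφker, he']
    have h2 : Ideal.comap φ (Ideal.span {d₁}) = Ideal.span {κ} ⊔ Ideal.span {e} := by
      rw [← hκ, ← Set.image_singleton, ← Ideal.map_span, Ideal.comap_map_of_surjective _ hφsurj, ← RingHom.ker_eq_comap_bot, hφker, he']
    rw [hKd'] at h1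
    rw [h1] at h2
    apply le_antisymm
    · rw [sup_comm]; rw [h2]; exact sup_le le_sup_right le_sup_left
    · refine sup_le le_sup_left ?_
      have : Ideal.span {κ} ≤ stalkIdeal 𝒦₁ (𝓔.subschemeι xe) ⊔ Ideal.span {e} := by rw [h2]; exact le_sup_left
      exact this.trans (sup_le le_sup_right le_sup_left)
  have hκm : κ ∈ maximalIdeal _ := hCm (hsum.symm ▸ Ideal.mem_sup_right (Ideal.mem_span_singleton_self κ))
  -- `κ` is a nonzerodivisor modulo `e`
  have hreg : ∀ z, κ * z ∈ Ideal.span {e} → z ∈ Ideal.span {e} := by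
    intro z hz
    rw [← he', ← hφker, RingHom.mem_ker] at hz ⊢
    rw [map_mul, hκ] at hz
    exact (mem_nonZeroDivisors_iff_right.mp hd₁) _ (by rw [mul_comm]; exact hz)
  rw [hsum]
  exact ringKrullDim_quotient_sup_span_le hd e κ hem he0 hκm hreg

end Summit.ResolutionOfSingularities.ResolutionOfSingularities.Cruxes.EquisingularLiftNat.Sections.CechShadow

end
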